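/-
# [B4] §2 p.577 — the MIXED second difference of the partition function `h_j` («|∂^ηh_j| ≤ O(M^{-1}),
|Δ^ηh_j| ≤ O(M^{-2})», here: the `η`-gradient of `h_j` is Lipschitz on scale `M`)

statement-level skeleton of published theorems with citation tags; proofs where landed; nothing here is a claim about
the Yang–Mills mass gap

[B4] = Balaban, *Regularity and decay of lattice Green's functions*, Commun. Math. Phys. 89 (1983) 571–597.

The partition of unity `h_j(x) = Π_μ h(x_μ/M − j_μ)` of §2 p.575 (`B4PartitionUnity22.hCube`, profile `h ∈ C₀^∞`) enters
the random-walk expansion through its sizes: p.577 «|∂^ηh_j| ≤ O(M^{-1}), |Δ^ηh_j| ≤ O(M^{-2})»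
(`B4PartitionUnity22.abs_hCube_diff_le`, `abs_hCube_second_diff_le`; on the fine lattice `B4Eq220PartitionSizes.grad_hZ_le`,
`secondDiff_hZ_le`).  The HÖLDER member of the Theorem (1.9) needs, through the Leibniz rules (2.3)–(2.4) p.575 for the
Hölder quotient of `h_j·(G_k(□_j,Ã_j)h_jf)` ((2.18) p.578), one more size of the same kind: the `η`-gradient of `h_j` is
LIPSCHITZ on scale `M`, i.e. the mixed second difference
`h_j(x′ + ηe_μ) − h_j(x′) − (h_j(x + ηe_μ) − h_j(x))` is `≤ (sup|h′|² + sup|h″|)·|η|·|x′ − x|₁/M²`.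

CONTENTS (all proved; real-variable calculus from `B4PartitionUnity22`):
* `abs_mixed_diff_le_D2` — one variable: `|f(t+δ+η) − f(t+δ) − f(t+η) + f(t)| ≤ sup|f″|·|δ||η|` (mean value theorem twice);
* `abs_hCube_mixed_diff_le` — one coordinate of the base point moved: the two cases `ν = μ` (second difference of the
  profile) and `ν ≠ μ` (product of two first differences), `≤ (D1(h)² + D2(h))|δ||η|/M²`;
* `abs_hCube_gradient_lipschitz` — the base point moved arbitrarily: `≤ (D1² + D2)|η|·Σ_ν|x′_ν − x_ν|/M²`;
* `mixedDiff_hZ_le` — on the fine lattice `L^{-k}ℤ^{d+1}` (mesh `n = η^{-1}`, large-cube size `K`):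
  `|h_j(x′+e_μ) − h_j(x′) − h_j(x+e_μ) + h_j(x)| ≤ (D1² + D2)·Σ_ν|x′_ν − x_ν|/(n²K²)`.

HONEST SCOPE.  Sizes of the concrete `h_j` only; nothing of the expansion itself.  No `def`, no `Prop` fact, no `sorry`;
axioms standard.
-/
import Literature.MathematicalPhysics.QuantumFieldTheory.Balaban1983to89.B4Eq220PartitionSizes

namespace Literature.MathematicalPhysics.QuantumFieldTheory.Balaban1983to89.B4HCubeMixedDiff

open Set
open Literature.MathematicalPhysics.QuantumFieldTheory.Balaban1983to89.B4PartitionUnity22 (hprof hCube D1 D2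
  contDiff_hprof hasCompactSupport_hprof hprof_nonneg hprof_le_one abs_deriv2_le_D2 D1_nonneg D2_nonneg abs_sub_le_D1)
open Literature.MathematicalPhysics.QuantumFieldTheory.Balaban1983to89.B4Eq220PartitionSizes (hZ)
open scoped ContDiff

noncomputable section

/-! ## 1. One variable: the mixed second difference -/

/-- **THE MIXED SECOND DIFFERENCE OF A `C₀^∞` FUNCTION**: `|f(t+δ+η) − f(t+δ) − f(t+η) + f(t)| ≤ sup|f″|·|δ|·|η|`
(mean value theorem twice: `g(u) = f(u+η) − f(u)` has `|g′| ≤ sup|f″|·|η|`).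
[cite: Balaban1983RegularityDecay, §2 p.577 «|Δ^ηh_j| ≤ O(M⁻²)»] -/
theorem abs_mixed_diff_le_D2 {f : ℝ → ℝ} (hf : ContDiff ℝ ∞ f) (hs : HasCompactSupport f) (t δ η : ℝ) :
    |f (t + δ + η) - f (t + δ) - f (t + η) + f t| ≤ D2 f * |δ| * |η| := by
  have hdiff : Differentiable ℝ f := hf.differentiable (by simp)
  have hdiff' : Differentiable ℝ (deriv f) :=
    (contDiff_infty_iff_deriv.mp hf).2.differentiable (by simp)
  have hg : ∀ u, HasDerivAt (fun u => f (u + η) - f u) (deriv f (u + η) - deriv f u) u := fun u =>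
    ((hdiff (u + η)).hasDerivAt.comp_add_const u η).sub (hdiff u).hasDerivAt
  have hgb : ∀ u, |deriv (fun u => f (u + η) - f u) u| ≤ D2 f * |η| := by
    intro u
    rw [(hg u).deriv]
    have h := Convex.norm_image_sub_le_of_norm_deriv_le (f := deriv f) (s := Set.univ)
      (fun x _ => (hdiff' x)) (fun x _ => by rw [Real.norm_eq_abs]; exact abs_deriv2_le_D2 hf hs x)
      convex_univ (mem_univ u) (mem_univ (u + η))
    simpa only [Real.norm_eq_abs, add_sub_cancel_left] using h
  have key := Convex.norm_image_sub_le_of_norm_deriv_le (f := fun u => f (u + η) - f u) (s := Set.univ)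
    (fun x _ => (hg x).differentiableAt) (fun x _ => by rw [Real.norm_eq_abs]; exact hgb x)
    convex_univ (mem_univ t) (mem_univ (t + δ))
  have hid : f (t + δ + η) - f (t + δ) - f (t + η) + f t = (f (t + δ + η) - f (t + δ)) - (f (t + η) - f t) := by
    ring
  rw [hid]
  calc |(f (t + δ + η) - f (t + δ)) - (f (t + η) - f t)| ≤ D2 f * |η| * ‖t + δ - t‖ := by
        simpa only [Real.norm_eq_abs] using key
    _ = D2 f * |δ| * |η| := by rw [Real.norm_eq_abs, add_sub_cancel_left]; ring

/-! ## 2. The product profile: one coordinate of the base point moved -/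

variable {ι : Type*} [Fintype ι] [DecidableEq ι]

omit [Fintype ι] in
/-- a sub-product of profile factors at a point updated in a coordinate of the sub-product changes by at most
`sup|h′|·|δ|/M`. [cite: Balaban1983RegularityDecay, §2 p.577 «|∂^ηh_j| ≤ O(M⁻¹)»] -/
theorem abs_subprod_update_sub_le {M : ℝ} (hM : 0 < M) (j : ι → ℤ) (x : ι → ℝ) {s : Finset ι} {ν : ι}
    (hν : ν ∈ s) (δ : ℝ) :
    |∏ c ∈ s, hprof (Function.update x ν (x ν + δ) c / M - j c) - ∏ c ∈ s, hprof (x c / M - j c)|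
      ≤ D1 hprof * |δ| / M := by
  rw [← Finset.mul_prod_erase s _ hν, ← Finset.mul_prod_erase s (fun c => hprof (x c / M - j c)) hν,
    Function.update_self]
  have hrest : ∏ c ∈ s.erase ν, hprof (Function.update x ν (x ν + δ) c / M - j c)
      = ∏ c ∈ s.erase ν, hprof (x c / M - j c) :=
    Finset.prod_congr rfl fun c hc => by rw [Function.update_of_ne (Finset.ne_of_mem_erase hc)]
  rw [hrest, ← sub_mul, abs_mul]
  have hd : |hprof ((x ν + δ) / M - j ν) - hprof (x ν / M - j ν)| ≤ D1 hprof * |δ| / M := by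
    have h := abs_sub_le_D1 contDiff_hprof hasCompactSupport_hprof (x ν / M - j ν) ((x ν + δ) / M - j ν)
    rw [show (x ν + δ) / M - (j ν : ℝ) - (x ν / M - j ν) = δ / M by ring, abs_div, abs_of_pos hM] at h
    simpa only [mul_div_assoc] using h
  have hR : |∏ c ∈ s.erase ν, hprof (x c / M - j c)| ≤ 1 := by
    rw [abs_of_nonneg (Finset.prod_nonneg fun _ _ => hprof_nonneg _)]
    exact Finset.prod_le_one (fun _ _ => hprof_nonneg _) fun _ _ => hprof_le_one _
  calc |hprof ((x ν + δ) / M - j ν) - hprof (x ν / M - j ν)| * |∏ c ∈ s.erase ν, hprof (x c / M - j c)|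
      ≤ D1 hprof * |δ| / M * 1 :=
        mul_le_mul hd hR (abs_nonneg _) (div_nonneg (mul_nonneg (D1_nonneg contDiff_hprof
          hasCompactSupport_hprof) (abs_nonneg _)) hM.le)
    _ = D1 hprof * |δ| / M := mul_one _

/-- the product split at the coordinate `μ`. [folklore] -/
private theorem hCube_split_at (M : ℝ) (j : ι → ℤ) (x : ι → ℝ) (μ : ι) :
    hCube M j x = hprof (x μ / M - j μ) * ∏ c ∈ Finset.univ.erase μ, hprof (x c / M - j c) :=
  (Finset.mul_prod_erase Finset.univ _ (Finset.mem_univ μ)).symm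

/-- the product at a point updated in the coordinate `μ`, split at `μ`. [folklore] -/
private theorem hCube_update_at (M : ℝ) (j : ι → ℤ) (x : ι → ℝ) (μ : ι) (v : ℝ) :
    hCube M j (Function.update x μ v) = hprof (v / M - j μ) * ∏ c ∈ Finset.univ.erase μ, hprof (x c / M - j c) := by
  unfold hCube
  rw [← Finset.mul_prod_erase Finset.univ _ (Finset.mem_univ μ), Function.update_self]
  congr 1
  exact Finset.prod_congr rfl fun c hc => by rw [Function.update_of_ne (Finset.ne_of_mem_erase hc)]

/-- **THE MIXED SECOND DIFFERENCE OF `h_j`, ONE COORDINATE OF THE BASE POINT MOVED**: for the base points `x` and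
`x + δe_ν` and the increment `ηe_μ`,
`|h_j(x + δe_ν + ηe_μ) − h_j(x + δe_ν) − h_j(x + ηe_μ) + h_j(x)| ≤ (sup|h′|² + sup|h″|)·|δ||η|/M²` — for `ν = μ` the
mixed difference of the profile, for `ν ≠ μ` the product of two first differences.
[cite: Balaban1983RegularityDecay, §2 p.577 «|∂^ηh_j| ≤ O(M⁻¹), |Δ^ηh_j| ≤ O(M⁻²)»] -/
theorem abs_hCube_mixed_diff_le {M : ℝ} (hM : 0 < M) (j : ι → ℤ) (x : ι → ℝ) (μ ν : ι) (δ η : ℝ) :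
    |hCube M j (Function.update (Function.update x ν (x ν + δ)) μ (Function.update x ν (x ν + δ) μ + η))
        - hCube M j (Function.update x ν (x ν + δ))
        - hCube M j (Function.update x μ (x μ + η)) + hCube M j x|
      ≤ (D1 hprof ^ 2 + D2 hprof) * |δ| * |η| / M ^ 2 := by
  have hD1 := D1_nonneg contDiff_hprof hasCompactSupport_hprof
  have hD2 := D2_nonneg contDiff_hprof hasCompactSupport_hprof
  by_cases hνμ : ν = μ
  · subst hνμ
    -- same coordinate: the mixed difference of the profile times the complementary factor
    rw [Function.update_self, Function.update_idem, hCube_update_at, hCube_update_at, hCube_update_at,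
      hCube_split_at M j x ν]
    set R := ∏ c ∈ Finset.univ.erase ν, hprof (x c / M - j c)
    set a := x ν / M - (j ν : ℝ) with ha
    rw [show (x ν + δ + η) / M - (j ν : ℝ) = a + δ / M + η / M by rw [ha]; ring,
      show (x ν + δ) / M - (j ν : ℝ) = a + δ / M by rw [ha]; ring,
      show (x ν + η) / M - (j ν : ℝ) = a + η / M by rw [ha]; ring,
      show hprof (a + δ / M + η / M) * R - hprof (a + δ / M) * R - hprof (a + η / M) * R + hprof a * R
        = (hprof (a + δ / M + η / M) - hprof (a + δ / M) - hprof (a + η / M) + hprof a) * R by ring, abs_mul]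
    have hR : |R| ≤ 1 := by
      rw [abs_of_nonneg (Finset.prod_nonneg fun _ _ => hprof_nonneg _)]
      exact Finset.prod_le_one (fun _ _ => hprof_nonneg _) fun _ _ => hprof_le_one _
    have hd := abs_mixed_diff_le_D2 contDiff_hprof hasCompactSupport_hprof a (δ / M) (η / M)
    rw [abs_div, abs_div, abs_of_pos hM] at hd
    calc _ ≤ D2 hprof * (|δ| / M) * (|η| / M) * 1 := mul_le_mul hd hR (abs_nonneg _) (by positivity)
      _ = D2 hprof * |δ| * |η| / M ^ 2 := by field_simp
      _ ≤ (D1 hprof ^ 2 + D2 hprof) * |δ| * |η| / M ^ 2 := by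
          apply div_le_div_of_nonneg_right _ (by positivity)
          have : 0 ≤ D1 hprof ^ 2 * |δ| * |η| := by positivity
          nlinarith
  · -- different coordinates: the product of the two first differences
    have hμν : μ ≠ ν := fun h => hνμ h.symm
    have hxδμ : Function.update x ν (x ν + δ) μ = x μ := Function.update_of_ne hμν _ _
    rw [hxδμ]
    -- split every term at the coordinate `μ`
    rw [hCube_update_at, hCube_split_at M j (Function.update x ν (x ν + δ)) μ, hxδμ, hCube_update_at,
      hCube_split_at M j x μ]
    set Rδ := ∏ c ∈ Finset.univ.erase μ, hprof (Function.update x ν (x ν + δ) c / M - j c)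
    set R := ∏ c ∈ Finset.univ.erase μ, hprof (x c / M - j c)
    rw [show hprof ((x μ + η) / M - j μ) * Rδ - hprof (x μ / M - j μ) * Rδ - hprof ((x μ + η) / M - j μ) * R
        + hprof (x μ / M - j μ) * R
        = (hprof ((x μ + η) / M - j μ) - hprof (x μ / M - j μ)) * (Rδ - R) by ring, abs_mul]
    have h1 : |hprof ((x μ + η) / M - j μ) - hprof (x μ / M - j μ)| ≤ D1 hprof * |η| / M := by
      have h := abs_sub_le_D1 contDiff_hprof hasCompactSupport_hprof (x μ / M - j μ) ((x μ + η) / M - j μ)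
      rw [show (x μ + η) / M - (j μ : ℝ) - (x μ / M - j μ) = η / M by ring, abs_div, abs_of_pos hM] at h
      simpa only [mul_div_assoc] using h
    have h2 : |Rδ - R| ≤ D1 hprof * |δ| / M :=
      abs_subprod_update_sub_le hM j x (Finset.mem_erase.2 ⟨hνμ, Finset.mem_univ ν⟩) δ
    calc _ ≤ (D1 hprof * |η| / M) * (D1 hprof * |δ| / M) := mul_le_mul h1 h2 (abs_nonneg _) (by positivity)
      _ = D1 hprof ^ 2 * |δ| * |η| / M ^ 2 := by field_simp
      _ ≤ (D1 hprof ^ 2 + D2 hprof) * |δ| * |η| / M ^ 2 := by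
          apply div_le_div_of_nonneg_right _ (by positivity)
          have : 0 ≤ D2 hprof * |δ| * |η| := by positivity
          nlinarith

/-! ## 3. The base point moved arbitrarily: the `η`-gradient of `h_j` is Lipschitz on scale `M` -/

/-- **THE `η`-GRADIENT OF `h_j` IS LIPSCHITZ ON SCALE `M`**: for any two base points `x, x′` and the increment `ηe_μ`,
`|h_j(x′ + ηe_μ) − h_j(x′) − (h_j(x + ηe_μ) − h_j(x))| ≤ (sup|h′|² + sup|h″|)·|η|·Σ_ν|x′_ν − x_ν|/M²` (coordinate by
coordinate through the points `x^{(s)} = (x′ on s, x off s)`).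
[cite: Balaban1983RegularityDecay, §2 p.577 «|∂^ηh_j| ≤ O(M⁻¹), |Δ^ηh_j| ≤ O(M⁻²)», (2.3)–(2.4) p.575] -/
theorem abs_hCube_gradient_lipschitz {M : ℝ} (hM : 0 < M) (j : ι → ℤ) (x x' : ι → ℝ) (μ : ι) (η : ℝ) :
    |hCube M j (Function.update x' μ (x' μ + η)) - hCube M j x'
        - (hCube M j (Function.update x μ (x μ + η)) - hCube M j x)|
      ≤ (D1 hprof ^ 2 + D2 hprof) * |η| * (∑ ν, |x' ν - x ν|) / M ^ 2 := by
  -- the increment functional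
  set g : (ι → ℝ) → ℝ := fun p => hCube M j (Function.update p μ (p μ + η)) - hCube M j p with hg
  -- induction over the set of coordinates already moved
  suffices h : ∀ s : Finset ι, |g (s.piecewise x' x) - g x|
      ≤ (D1 hprof ^ 2 + D2 hprof) * |η| * (∑ ν ∈ s, |x' ν - x ν|) / M ^ 2 by
    have := h Finset.univ
    rwa [Finset.piecewise_univ] at this
  intro s
  induction s using Finset.induction_on with
  | empty => simp [Finset.piecewise_empty]
  | @insert ν s hν ih =>
      have hstep : (insert ν s).piecewise x' x
          = Function.update (s.piecewise x' x) ν ((s.piecewise x' x) ν + (x' ν - x ν)) := by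
        rw [Finset.piecewise_insert, Finset.piecewise_eq_of_notMem _ _ _ hν, add_sub_cancel]
      have hone := abs_hCube_mixed_diff_le hM j (s.piecewise x' x) μ ν (x' ν - x ν) η
      rw [← hstep] at hone
      rw [Finset.sum_insert hν]
      calc |g ((insert ν s).piecewise x' x) - g x|
          ≤ |g ((insert ν s).piecewise x' x) - g (s.piecewise x' x)| + |g (s.piecewise x' x) - g x| :=
            abs_sub_le _ _ _
        _ ≤ (D1 hprof ^ 2 + D2 hprof) * |x' ν - x ν| * |η| / M ^ 2
            + (D1 hprof ^ 2 + D2 hprof) * |η| * (∑ ν ∈ s, |x' ν - x ν|) / M ^ 2 := by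
            refine add_le_add ?_ ih
            rw [hg]
            simp only
            rw [show hCube M j (Function.update ((insert ν s).piecewise x' x) μ (((insert ν s).piecewise x' x) μ + η))
                - hCube M j ((insert ν s).piecewise x' x)
                - (hCube M j (Function.update (s.piecewise x' x) μ ((s.piecewise x' x) μ + η))
                    - hCube M j (s.piecewise x' x))
              = hCube M j (Function.update ((insert ν s).piecewise x' x) μ (((insert ν s).piecewise x' x) μ + η))
                - hCube M j ((insert ν s).piecewise x' x)
                - hCube M j (Function.update (s.piecewise x' x) μ ((s.piecewise x' x) μ + η))
                + hCube M j (s.piecewise x' x) by ring]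
            exact hone
        _ = (D1 hprof ^ 2 + D2 hprof) * |η| * (|x' ν - x ν| + ∑ ν ∈ s, |x' ν - x ν|) / M ^ 2 := by ring

/-! ## 4. On the fine lattice `L^{-k}ℤ^{d+1}` -/

variable {d : ℕ}

/-- positions of fine sites: `x ↦ x/n`, and `x + e_μ ↦` the `μ`-coordinate updated by `1/n`. [folklore] -/
private theorem pos_add_single (n : ℕ) (x : Fin (d + 1) → ℤ) (μ : Fin (d + 1)) :
    (fun ν => (((x + Pi.single μ 1 : Fin (d + 1) → ℤ) ν : ℤ) : ℝ) / n)
      = Function.update (fun ν => ((x ν : ℤ) : ℝ) / n) μ (((x μ : ℤ) : ℝ) / n + 1 / n) := by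
  funext ν
  by_cases hν : ν = μ
  · subst hν
    rw [Function.update_self, Pi.add_apply, Pi.single_eq_same]
    push_cast
    ring
  · rw [Function.update_of_ne hν, Pi.add_apply, Pi.single_eq_of_ne hν, add_zero]

/-- **THE MIXED SECOND DIFFERENCE OF `h_j` ON THE FINE LATTICE** (mesh `n = η^{-1}`, large-cube size `K`):
`|h_j(x′ + e_μ) − h_j(x′) − h_j(x + e_μ) + h_j(x)| ≤ (sup|h′|² + sup|h″|)·Σ_ν|x′_ν − x_ν|/(n²K²)` — the lattice gradient
`η^{-1}(h_j(· + ηe_μ) − h_j)` is Lipschitz with constant `O(M^{-2})` in unit-lattice distance.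
[cite: Balaban1983RegularityDecay, §2 p.577 «|∂^ηh_j| ≤ O(M⁻¹), |Δ^ηh_j| ≤ O(M⁻²)»] -/
theorem mixedDiff_hZ_le {n K : ℕ} (hn : 1 ≤ n) (hK : 1 ≤ K) (j : Fin (d + 1) → ℤ) (x x' : Fin (d + 1) → ℤ)
    (μ : Fin (d + 1)) :
    |hZ n K j (x' + Pi.single μ 1) - hZ n K j x' - hZ n K j (x + Pi.single μ 1) + hZ n K j x|
      ≤ (D1 hprof ^ 2 + D2 hprof) * (∑ ν, |((x' ν : ℤ) : ℝ) - x ν|) / ((n : ℝ) ^ 2 * (K : ℝ) ^ 2) := by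
  have hnr : (0 : ℝ) < n := by exact_mod_cast hn
  have hKr : (0 : ℝ) < K := by exact_mod_cast hK
  unfold hZ
  rw [pos_add_single, pos_add_single]
  have h := abs_hCube_gradient_lipschitz hKr j (fun ν => ((x ν : ℤ) : ℝ) / n) (fun ν => ((x' ν : ℤ) : ℝ) / n) μ
    (1 / n)
  have hsum : ∑ ν, |((x' ν : ℤ) : ℝ) / n - ((x ν : ℤ) : ℝ) / n| = (∑ ν, |((x' ν : ℤ) : ℝ) - x ν|) / n := by
    rw [Finset.sum_div]
    refine Finset.sum_congr rfl fun ν _ => ?_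
    rw [← sub_div, abs_div, abs_of_pos hnr]
  rw [hsum, abs_of_pos (by positivity : (0 : ℝ) < 1 / n)] at h
  rw [show hCube (K : ℝ) j (Function.update (fun ν => ((x' ν : ℤ) : ℝ) / n) μ (((x' μ : ℤ) : ℝ) / n + 1 / n))
      - hCube (K : ℝ) j (fun ν => ((x' ν : ℤ) : ℝ) / n)
      - hCube (K : ℝ) j (Function.update (fun ν => ((x ν : ℤ) : ℝ) / n) μ (((x μ : ℤ) : ℝ) / n + 1 / n))
      + hCube (K : ℝ) j (fun ν => ((x ν : ℤ) : ℝ) / n)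
    = hCube (K : ℝ) j (Function.update (fun ν => ((x' ν : ℤ) : ℝ) / n) μ (((x' μ : ℤ) : ℝ) / n + 1 / n))
      - hCube (K : ℝ) j (fun ν => ((x' ν : ℤ) : ℝ) / n)
      - (hCube (K : ℝ) j (Function.update (fun ν => ((x ν : ℤ) : ℝ) / n) μ (((x μ : ℤ) : ℝ) / n + 1 / n))
        - hCube (K : ℝ) j (fun ν => ((x ν : ℤ) : ℝ) / n)) by ring]
  refine h.trans (le_of_eq ?_)
  field_simp

end

end Literature.MathematicalPhysics.QuantumFieldTheory.Balaban1983to89.B4HCubeMixedDiff
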